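import Literature.MathematicalPhysics.KineticTheory.HarmonicChaosDecomposition
import HarnessLib

/-!
# The free Koopman group on Wick vectors: matrix coefficients, their time derivative, and the slot rule
(stub `stub_wickShellDynamic` (K6) of line `gram-pencil-harmonic-chaos`, crux `EmbeddedDrudeMourre.DrudeDissolution`,
item stmt-AtomisticToContinuum-12593; `--supports` file, closes nothing)

WHAT. Chaos-side (`HarmonicChaosDecomposition.lean`) lemmas for the harmonic spectral formula:
* `inner_wickVector_chaosKoopman`: `⟪ι[:f:], U⁰_t ι[:g:]⟫ = Σ_{m+n = deg g} ∫ conj(Φ_f) e^{itΩ} Φ_g dσ_{m,n}` — the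
  `lp` inner product is a finite sum of sector integrals of the continuous Wick kernels;
* `hasDerivAt_integral_mul_exp`: `d/dt ∫ F e^{itΩ} = ∫ F (iΩ) e^{itΩ}` for continuous `F, Ω` on a compact space;
* `sum_wickKernel_update`: if a map `L` on coefficient data multiplies thermal waves by `−iω`
  (`w_{Lf} = −iω w_f`, stub KAlg (c)), then `Σ_i Φ[f₀,…,Lf_i,…]_{m,n} = (iΩ_{m,n}) Φ[f]_{m,n}` pointwise on the shell
  (a creation slot carries `conj(−iω w) = +iω conj w`, an annihilation slot `−iω w`);
* `hasDerivAt_inner_wickVector_chaosKoopman` (registered helper stub `inner_wickVector_chaosKoopman_hasDerivAt`):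
  `d/ds ⟪ι[:f:], U⁰_s ι[:h:]⟫ = Σ_k ⟪ι[:f:], U⁰_s ι[:h[k ← Lh_k]:]⟫` — the free matrix coefficients solve the closed
  linear system driven by `L` slot by slot.

HOW. `lp.inner_eq_tsum` + `tsum_eq_sum` (sectors off `m + n = deg` vanish, `wickKernel_of_ne`), `L2.inner_def` and the
a.e. representatives `coeFn_wickVector`, `coeFn_sectorKoopman`; dominated differentiation
(`hasDerivAt_integral_of_dominated_loc_of_deriv_le`) with the constant bound `sup‖F‖ · sup|Ω|`; the slot rule by
reindexing the slot sum along each assignment `β : Fin m ⊕ Fin n ≃ Fin N` and `Finset.prod_update_of_mem`.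
-/

noncomputable section

namespace Summit.AtomisticToContinuum.FouriersLaw.Theorems.DrudeDissolution.GramPencilHarmonicChaos

open MeasureTheory Filter Set Function Topology
open scoped InnerProductSpace ENNReal ComplexConjugate
open Literature.MathematicalPhysics.KineticTheory
open Literature.MathematicalPhysics.KineticTheory.HeatConduction
open HarmonicChaos
open PinnedChainKinetic (𝕋 𝕋3 μ𝕋 μ𝕋3 k₄ sinT dispersion)
open scoped Literature.MathematicalPhysics.KineticTheory.HeatConduction.PinnedChainKinetic

/-- Off the sectors with `m + n = N`, the chaos vector of a degree-`N` monomial vanishes. [folklore] -/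
theorem wickVector_apply_of_ne (ω₂ T : ℝ) {N : ℕ} (f : Fin N → TestFn) {s : SectorIndex}
    (hs : s.cr + s.an ≠ N) : wickVector ω₂ T f s = 0 := by
  rw [wickVector_apply, wickKernel_of_ne ω₂ T f hs, toL2C_zero]

/-- **Matrix coefficients of the free Koopman group between Wick vectors** as a finite sum of sector
integrals: `⟪ι[:f:], U⁰_t ι[:g:]⟫ = Σ_{m+n = M} ∫ conj(Φ_f) · e^{itΩ} Φ_g dσ_{m,n}`. [folklore] -/
theorem inner_wickVector_chaosKoopman {ω₂ : ℝ} (hω : 0 < ω₂) (T t : ℝ) {N M : ℕ}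
    (f : Fin N → TestFn) (g : Fin M → TestFn) :
    ⟪wickVector ω₂ T f, chaosKoopman ω₂ t (wickVector ω₂ T g)⟫_ℂ =
      ∑ s ∈ (finite_sectorIndex_sum M).toFinset,
        ∫ κ, conj (wickKernel ω₂ T f s.cr s.an κ) *
          (Complex.exp (↑(t * sectorPhase ω₂ κ) * Complex.I) * wickKernel ω₂ T g s.cr s.an κ)
            ∂(shellMeasure s.cr s.an) := by
  rw [lp.inner_eq_tsum, tsum_eq_sum (s := (finite_sectorIndex_sum M).toFinset)]
  · refine Finset.sum_congr rfl fun s _ => ?_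
    rw [chaosKoopman_apply, MeasureTheory.L2.inner_def]
    refine integral_congr_ae ?_
    filter_upwards [coeFn_wickVector hω T f s, coeFn_wickVector hω T g s,
      coeFn_sectorKoopman ω₂ t (wickVector ω₂ T g s)] with κ h1 h2 h3
    rw [RCLike.inner_apply', h1, h3, h2]
  · intro s hs
    have hs' : s.cr + s.an ≠ M := by
      simpa [Set.Finite.mem_toFinset] using hs
    rw [chaosKoopman_apply, wickVector_apply_of_ne ω₂ T g hs', map_zero, inner_zero_right]

/-- The static case `t = 0`: `⟪ι[:f:], ι[:g:]⟫ = Σ_{m+n = M} ∫ conj(Φ_f) Φ_g dσ_{m,n}`. [folklore] -/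
theorem inner_wickVector_wickVector {ω₂ : ℝ} (hω : 0 < ω₂) (T : ℝ) {N M : ℕ}
    (f : Fin N → TestFn) (g : Fin M → TestFn) :
    ⟪wickVector ω₂ T f, wickVector ω₂ T g⟫_ℂ =
      ∑ s ∈ (finite_sectorIndex_sum M).toFinset,
        ∫ κ, conj (wickKernel ω₂ T f s.cr s.an κ) * wickKernel ω₂ T g s.cr s.an κ
            ∂(shellMeasure s.cr s.an) := by
  have h := inner_wickVector_chaosKoopman hω T 0 f g
  rw [chaosKoopman_zero] at h
  rw [h]
  refine Finset.sum_congr rfl fun s _ => integral_congr_ae (ae_of_all _ fun κ => ?_)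
  simp


/-- **Differentiation of an oscillatory integral in time**: for continuous `F : X → ℂ` and `Ω : X → ℝ` on a
compact space with a finite measure, `t ↦ ∫ F e^{itΩ}` has derivative `∫ F (iΩ) e^{itΩ}`. [folklore] -/
theorem hasDerivAt_integral_mul_exp {X : Type*} [MeasurableSpace X] [TopologicalSpace X] [CompactSpace X]
    [OpensMeasurableSpace X] (ν : Measure X) [IsFiniteMeasure ν] {F : X → ℂ} {Ω : X → ℝ}
    (hF : Continuous F) (hΩ : Continuous Ω) (t : ℝ) :
    HasDerivAt (fun t : ℝ => ∫ x, F x * Complex.exp (↑(t * Ω x) * Complex.I) ∂ν)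
      (∫ x, F x * ((Ω x : ℂ) * Complex.I) * Complex.exp (↑(t * Ω x) * Complex.I) ∂ν) t := by
  obtain ⟨CF, hCF⟩ := isCompact_univ.exists_bound_of_continuousOn hF.continuousOn
  obtain ⟨CΩ, hCΩ⟩ := isCompact_univ.exists_bound_of_continuousOn hΩ.continuousOn
  have hphase : ∀ s : ℝ, Continuous fun x => Complex.exp (↑(s * Ω x) * Complex.I) := fun s =>
    Complex.continuous_exp.comp ((Complex.continuous_ofReal.comp (continuous_const.mul hΩ)).mul
      continuous_const)
  have hmeas : ∀ s : ℝ, AEStronglyMeasurable (fun x => F x * Complex.exp (↑(s * Ω x) * Complex.I)) ν :=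
    fun s => (hF.mul (hphase s)).aestronglyMeasurable
  have hint : Integrable (fun x => F x * Complex.exp (↑(t * Ω x) * Complex.I)) ν :=
    (hF.mul (hphase t)).integrable_of_hasCompactSupport (HasCompactSupport.of_compactSpace _)
  have hmeas' : AEStronglyMeasurable
      (fun x => F x * ((Ω x : ℂ) * Complex.I) * Complex.exp (↑(t * Ω x) * Complex.I)) ν :=
    ((hF.mul ((Complex.continuous_ofReal.comp hΩ).mul continuous_const)).mul
      (hphase t)).aestronglyMeasurable
  have hderiv : ∀ᵐ x ∂ν, ∀ s ∈ (univ : Set ℝ),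
      HasDerivAt (fun s : ℝ => F x * Complex.exp (↑(s * Ω x) * Complex.I))
        (F x * ((Ω x : ℂ) * Complex.I) * Complex.exp (↑(s * Ω x) * Complex.I)) s := by
    refine ae_of_all _ fun x s _ => ?_
    have h1 : HasDerivAt (fun s : ℝ => ((s * Ω x : ℝ) : ℂ) * Complex.I) (((1 * Ω x : ℝ) : ℂ) * Complex.I) s :=
      (((hasDerivAt_id s).mul_const (Ω x)).ofReal_comp).mul_const Complex.I
    have h2 := (h1.cexp).const_mul (F x)
    refine h2.congr_deriv ?_
    push_cast
    ring
  have hbound : ∀ᵐ x ∂ν, ∀ s ∈ (univ : Set ℝ),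
      ‖F x * ((Ω x : ℂ) * Complex.I) * Complex.exp (↑(s * Ω x) * Complex.I)‖ ≤ CF * |CΩ| := by
    refine ae_of_all _ fun x s _ => ?_
    rw [norm_mul, norm_mul, Complex.norm_exp_ofReal_mul_I, mul_one, norm_mul, Complex.norm_I,
      mul_one, Complex.norm_real]
    have h1 := hCF x (mem_univ x)
    have h2 := hCΩ x (mem_univ x)
    rw [Real.norm_eq_abs] at h2 ⊢
    have hF0 : 0 ≤ CF := (norm_nonneg _).trans h1
    exact mul_le_mul h1 (h2.trans (le_abs_self _)) (abs_nonneg _) hF0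
  exact (hasDerivAt_integral_of_dominated_loc_of_deriv_le (F' := fun s x =>
      F x * ((Ω x : ℂ) * Complex.I) * Complex.exp (↑(s * Ω x) * Complex.I)) univ_mem
    (Eventually.of_forall hmeas) hint hmeas' hbound (integrable_const _) hderiv).2

/-- Replacing one factor of a finite product by a multiple of itself. [folklore] -/
theorem prod_update_mul_self {ι : Type*} [Fintype ι] [DecidableEq ι] (G : ι → ℂ) (i₀ : ι) (c : ℂ) :
    ∏ i, Function.update G i₀ (c * G i₀) i = c * ∏ i, G i := by
  rw [Finset.prod_update_of_mem (Finset.mem_univ i₀),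
    Finset.prod_eq_mul_prod_sdiff_singleton_of_mem (Finset.mem_univ i₀) G]
  ring

/-- The slot sum for a fixed assignment `β` of the `N` factors to `m` creation and `n` annihilation slots:
replacing in turn each factor `f_i` by `L f_i` and summing over `i` multiplies the product of thermal waves
by `i Ω_{m,n}(κ)`. [folklore] -/
theorem sum_slot_update {ω₂ T : ℝ} {L : TestFn → TestFn}
    (hL : ∀ (f : TestFn) (k : 𝕋), thermalWave ω₂ T (L f) k =
      -Complex.I * (dispersion ω₂ k : ℂ) * thermalWave ω₂ T f k)
    {N : ℕ} (h : Fin N → TestFn) (m n : ℕ) (κ : Shell m n) (β : (Fin m ⊕ Fin n) ≃ Fin N) :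
      ∑ i₁, (∏ i, conj (thermalWave ω₂ T (Function.update h i₁ (L (h i₁)) (β (Sum.inl i)))
          ((κ : SectorConfig m n).1 i))) *
        ∏ j, thermalWave ω₂ T (Function.update h i₁ (L (h i₁)) (β (Sum.inr j)))
          ((κ : SectorConfig m n).2 j) =
      ((sectorPhase ω₂ κ : ℂ) * Complex.I) *
        ((∏ i, conj (thermalWave ω₂ T (h (β (Sum.inl i))) ((κ : SectorConfig m n).1 i))) *
          ∏ j, thermalWave ω₂ T (h (β (Sum.inr j))) ((κ : SectorConfig m n).2 j)) := by
  classical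
  -- reindex the slot sum along `β`
  rw [← Equiv.sum_comp β, Fintype.sum_sum_type]
  set Gc : Fin m → ℂ := fun i => conj (thermalWave ω₂ T (h (β (Sum.inl i))) ((κ : SectorConfig m n).1 i))
    with hGc
  set Ga : Fin n → ℂ := fun j => thermalWave ω₂ T (h (β (Sum.inr j))) ((κ : SectorConfig m n).2 j)
    with hGa
  have hinl : Injective (fun i : Fin m => β (Sum.inl i)) :=
    β.injective.comp Sum.inl_injective
  have hinr : Injective (fun j : Fin n => β (Sum.inr j)) :=
    β.injective.comp Sum.inr_injective
  -- creation slots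
  have hc : ∀ i₀ : Fin m,
      (∏ i, conj (thermalWave ω₂ T (Function.update h (β (Sum.inl i₀)) (L (h (β (Sum.inl i₀))))
          (β (Sum.inl i))) ((κ : SectorConfig m n).1 i))) *
        ∏ j, thermalWave ω₂ T (Function.update h (β (Sum.inl i₀)) (L (h (β (Sum.inl i₀))))
          (β (Sum.inr j))) ((κ : SectorConfig m n).2 j) =
      (Complex.I * (dispersion ω₂ ((κ : SectorConfig m n).1 i₀) : ℂ)) * ((∏ i, Gc i) * ∏ j, Ga j) := by
    intro i₀
    have h1 : (fun i => conj (thermalWave ω₂ T (Function.update h (β (Sum.inl i₀))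
        (L (h (β (Sum.inl i₀)))) (β (Sum.inl i))) ((κ : SectorConfig m n).1 i))) =
        Function.update Gc i₀ ((Complex.I * (dispersion ω₂ ((κ : SectorConfig m n).1 i₀) : ℂ)) * Gc i₀) := by
      funext i
      by_cases hi : i = i₀
      · subst hi
        rw [Function.update_self, Function.update_self, hL, hGc]
        simp only [map_mul, map_neg, Complex.conj_I, Complex.conj_ofReal]
        ring
      · rw [Function.update_of_ne hi, Function.update_of_ne (hinl.ne hi)]
    have h2 : (fun j => thermalWave ω₂ T (Function.update h (β (Sum.inl i₀)) (L (h (β (Sum.inl i₀))))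
        (β (Sum.inr j))) ((κ : SectorConfig m n).2 j)) = Ga := by
      funext j
      rw [Function.update_of_ne (β.injective.ne Sum.inr_ne_inl)]
    rw [h1, h2, prod_update_mul_self]
    ring
  -- annihilation slots
  have ha : ∀ j₀ : Fin n,
      (∏ i, conj (thermalWave ω₂ T (Function.update h (β (Sum.inr j₀)) (L (h (β (Sum.inr j₀))))
          (β (Sum.inl i))) ((κ : SectorConfig m n).1 i))) *
        ∏ j, thermalWave ω₂ T (Function.update h (β (Sum.inr j₀)) (L (h (β (Sum.inr j₀))))
          (β (Sum.inr j))) ((κ : SectorConfig m n).2 j) =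
      (-Complex.I * (dispersion ω₂ ((κ : SectorConfig m n).2 j₀) : ℂ)) * ((∏ i, Gc i) * ∏ j, Ga j) := by
    intro j₀
    have h1 : (fun j => thermalWave ω₂ T (Function.update h (β (Sum.inr j₀)) (L (h (β (Sum.inr j₀))))
        (β (Sum.inr j))) ((κ : SectorConfig m n).2 j)) =
        Function.update Ga j₀ ((-Complex.I * (dispersion ω₂ ((κ : SectorConfig m n).2 j₀) : ℂ)) * Ga j₀) := by
      funext j
      by_cases hj : j = j₀
      · subst hj
        rw [Function.update_self, Function.update_self, hL, hGa]
      · rw [Function.update_of_ne hj, Function.update_of_ne (hinr.ne hj)]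
    have h2 : (fun i => conj (thermalWave ω₂ T (Function.update h (β (Sum.inr j₀))
        (L (h (β (Sum.inr j₀)))) (β (Sum.inl i))) ((κ : SectorConfig m n).1 i))) = Gc := by
      funext i
      rw [Function.update_of_ne (β.injective.ne Sum.inl_ne_inr)]
    rw [h1, h2, prod_update_mul_self]
    ring
  simp_rw [hc, ha]
  rw [← Finset.sum_mul, ← Finset.sum_mul, sectorPhase]
  push_cast
  rw [← Finset.mul_sum, ← Finset.mul_sum]
  ring


/-- **The linearised generator acts on Wick kernels as multiplication by `i Ω_{m,n}`**: if a linear map `L`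
on coefficient data multiplies thermal waves by `−iω` (`w_{Lf} = −iω w_f`), then
`Σ_i Φ[f₀,…,Lf_i,…](κ) = i Ω_{m,n}(κ) Φ[f](κ)` (a creation slot carries `conj(−iω w) = +iω conj w`, an
annihilation slot `−iω w`). [folklore] -/
theorem sum_wickKernel_update {ω₂ T : ℝ} {L : TestFn → TestFn}
    (hL : ∀ (f : TestFn) (k : 𝕋), thermalWave ω₂ T (L f) k =
      -Complex.I * (dispersion ω₂ k : ℂ) * thermalWave ω₂ T f k)
    {N : ℕ} (h : Fin N → TestFn) (m n : ℕ) (κ : Shell m n) :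
    ∑ i, wickKernel ω₂ T (Function.update h i (L (h i))) m n κ =
      ((sectorPhase ω₂ κ : ℂ) * Complex.I) * wickKernel ω₂ T h m n κ := by
  classical
  -- the slot sum for a fixed assignment `β`
  have key : ∀ β : (Fin m ⊕ Fin n) ≃ Fin N,
      ∑ i₁, (∏ i, conj (thermalWave ω₂ T (Function.update h i₁ (L (h i₁)) (β (Sum.inl i)))
          ((κ : SectorConfig m n).1 i))) *
        ∏ j, thermalWave ω₂ T (Function.update h i₁ (L (h i₁)) (β (Sum.inr j)))
          ((κ : SectorConfig m n).2 j) =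
      ((sectorPhase ω₂ κ : ℂ) * Complex.I) *
        ((∏ i, conj (thermalWave ω₂ T (h (β (Sum.inl i))) ((κ : SectorConfig m n).1 i))) *
          ∏ j, thermalWave ω₂ T (h (β (Sum.inr j))) ((κ : SectorConfig m n).2 j)) := by
    intro β
    exact sum_slot_update hL h m n κ β
  unfold wickKernel
  simp_rw [Finset.mul_sum]
  rw [Finset.sum_comm]
  refine Finset.sum_congr rfl fun β _ => ?_
  rw [← Finset.mul_sum, key β]
  ring



/-- **Time derivative of the free matrix coefficients between Wick vectors**: if `L` multiplies thermal
waves by `−iω`, then `d/ds ⟪ι[:f:], U⁰_s ι[:h:]⟫ = Σ_k ⟪ι[:f:], U⁰_s ι[:h[k ← L h_k]:]⟫` — the free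
generator acts on Wick vectors slot by slot through `L`. [folklore] -/
theorem hasDerivAt_inner_wickVector_chaosKoopman {ω₂ T : ℝ} (hω : 0 < ω₂) {L : TestFn → TestFn}
    (hL : ∀ (f : TestFn) (k : 𝕋), thermalWave ω₂ T (L f) k =
      -Complex.I * (dispersion ω₂ k : ℂ) * thermalWave ω₂ T f k)
    {N M : ℕ} (f : Fin N → TestFn) (h : Fin M → TestFn) (s : ℝ) :
    HasDerivAt (fun s : ℝ => ⟪wickVector ω₂ T f, chaosKoopman ω₂ s (wickVector ω₂ T h)⟫_ℂ)
      (∑ k, ⟪wickVector ω₂ T f,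
        chaosKoopman ω₂ s (wickVector ω₂ T (Function.update h k (L (h k))))⟫_ℂ) s := by
  classical
  set S := (finite_sectorIndex_sum M).toFinset with hS
  -- continuity of the kernels involved
  have hcf : ∀ s : SectorIndex, Continuous fun κ : Shell s.cr s.an =>
      conj (wickKernel ω₂ T f s.cr s.an κ) * wickKernel ω₂ T h s.cr s.an κ := fun s =>
    (Complex.continuous_conj.comp (continuous_wickKernel hω T f _ _)).mul (continuous_wickKernel hω T h _ _)
  have hexp : ∀ (s : SectorIndex) (r : ℝ), Continuous fun κ : Shell s.cr s.an =>
      Complex.exp (↑(r * sectorPhase ω₂ κ) * Complex.I) := fun s r =>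
    Complex.continuous_exp.comp ((Complex.continuous_ofReal.comp
      (continuous_const.mul (continuous_sectorPhase ω₂ _ _))).mul continuous_const)
  -- rewrite the matrix coefficient as a finite sum of oscillatory integrals
  have hfun : (fun s : ℝ => ⟪wickVector ω₂ T f, chaosKoopman ω₂ s (wickVector ω₂ T h)⟫_ℂ) =
      fun s : ℝ => ∑ σ ∈ S, ∫ κ, (conj (wickKernel ω₂ T f σ.cr σ.an κ) * wickKernel ω₂ T h σ.cr σ.an κ) *
        Complex.exp (↑(s * sectorPhase ω₂ κ) * Complex.I) ∂(shellMeasure σ.cr σ.an) := by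
    funext s
    rw [inner_wickVector_chaosKoopman hω]
    refine Finset.sum_congr rfl fun σ _ => integral_congr_ae (ae_of_all _ fun κ => ?_)
    ring
  rw [hfun]
  have hder := HasDerivAt.fun_sum (u := S) fun σ _ =>
    hasDerivAt_integral_mul_exp (shellMeasure σ.cr σ.an) (hcf σ) (continuous_sectorPhase ω₂ _ _) s
  refine hder.congr_deriv ?_
  symm
  calc ∑ k, ⟪wickVector ω₂ T f, chaosKoopman ω₂ s (wickVector ω₂ T (Function.update h k (L (h k))))⟫_ℂ
      = ∑ k, ∑ σ ∈ S, ∫ κ, conj (wickKernel ω₂ T f σ.cr σ.an κ) *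
          (Complex.exp (↑(s * sectorPhase ω₂ κ) * Complex.I) *
            wickKernel ω₂ T (Function.update h k (L (h k))) σ.cr σ.an κ) ∂(shellMeasure σ.cr σ.an) := by
        simp_rw [inner_wickVector_chaosKoopman hω, hS]
    _ = ∑ σ ∈ S, ∑ k, ∫ κ, conj (wickKernel ω₂ T f σ.cr σ.an κ) *
          (Complex.exp (↑(s * sectorPhase ω₂ κ) * Complex.I) *
            wickKernel ω₂ T (Function.update h k (L (h k))) σ.cr σ.an κ) ∂(shellMeasure σ.cr σ.an) :=
        Finset.sum_comm
    _ = ∑ σ ∈ S, ∫ κ, ∑ k, conj (wickKernel ω₂ T f σ.cr σ.an κ) *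
          (Complex.exp (↑(s * sectorPhase ω₂ κ) * Complex.I) *
            wickKernel ω₂ T (Function.update h k (L (h k))) σ.cr σ.an κ) ∂(shellMeasure σ.cr σ.an) := by
        refine Finset.sum_congr rfl fun σ _ => ?_
        rw [integral_finsetSum]
        intro k _
        exact (((Complex.continuous_conj.comp (continuous_wickKernel hω T f _ _)).mul
          ((hexp σ s).mul (continuous_wickKernel hω T _ _ _))).integrable_of_hasCompactSupport
          (HasCompactSupport.of_compactSpace _))
    _ = ∑ σ ∈ S, ∫ κ, (conj (wickKernel ω₂ T f σ.cr σ.an κ) * wickKernel ω₂ T h σ.cr σ.an κ) *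
          ((sectorPhase ω₂ κ : ℂ) * Complex.I) * Complex.exp (↑(s * sectorPhase ω₂ κ) * Complex.I)
            ∂(shellMeasure σ.cr σ.an) := by
        refine Finset.sum_congr rfl fun σ _ => integral_congr_ae (ae_of_all _ fun κ => ?_)
        beta_reduce
        rw [← Finset.mul_sum, ← Finset.mul_sum, sum_wickKernel_update hL]
        ring


/-- **Time derivative of the free matrix coefficients between Wick vectors** (closed `∀`-form registered for this
helper file): if `L` multiplies thermal waves by `−iω`, then
`d/ds ⟪ι[:f:], U⁰_s ι[:h:]⟫ = Σ_k ⟪ι[:f:], U⁰_s ι[:h[k ← L h_k]:]⟫`. [folklore] -/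
theorem inner_wickVector_chaosKoopman_hasDerivAt :
    ∀ (ω₂ T : ℝ), 0 < ω₂ → ∀ (L : TestFn → TestFn),
      (∀ (f : TestFn) (k : 𝕋), thermalWave ω₂ T (L f) k = -Complex.I * (PinnedChainKinetic.dispersion ω₂ k : ℂ) * thermalWave ω₂ T f k) →
      ∀ (N M : ℕ) (f : Fin N → TestFn) (h : Fin M → TestFn) (s : ℝ),
        HasDerivAt (fun s : ℝ => ⟪wickVector ω₂ T f, chaosKoopman ω₂ s (wickVector ω₂ T h)⟫_ℂ)
          (∑ k : Fin M, ⟪wickVector ω₂ T f, chaosKoopman ω₂ s (wickVector ω₂ T (Function.update h k (L (h k))))⟫_ℂ) s :=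
  fun _ _ hω _ hL _ _ f h s => hasDerivAt_inner_wickVector_chaosKoopman hω hL f h s

end Summit.AtomisticToContinuum.FouriersLaw.Theorems.DrudeDissolution.GramPencilHarmonicChaos

end
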